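import Literature.NumberTheory.EllipticCurves.TowerLocalH1CartesianProofs
import Literature.NumberTheory.GaloisRepresentations.BlochKatoSelmerGroup
import HarnessLib

/-!
# The saturated condition of a presented tower with STRICT (ordinary) cores, propagated to the residual module,
# is the residual strict kernel (theorems only)

`Proofs` file (theorems only; no definition, no named fact, no instance, no `sorry`).  Companion of
`TowerLocalH1LiftExactProofs` / `TowerSaturatedCartesianPresentedProofs` (the presented-tower currency: `ρ j` discrete
`Γ_F`-modules `W j`, ONE two-index family `f a b : W a → W b` — reductions for `b ≤ a`, `×π^{b-a}` for `a ≤ b` — and Kőnig's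
lemma for compatible families) and of `BlochKatoSelmerGroup` (`strictSubgroup = ker (H¹(F, W) → H¹(F, W / W⁺))`).

Setting (Howard's `F_𝔮` at a place `v ∣ p`, [B. Howard, Compositio Math. 140 (2004), §3.1–3.2, arXiv:1202.6340 p. 15 L56–66,
p. 16 L5–6]; cell `pub/bsd-print-x9`, memo `HOME/x9-p1-w3/H5B-AT-P-PLAN-w3g5.md`, file V1): stable «plus parts» `Fil j ≤ W j`
compatible with every `f a b`, the strict cores `C_j = ker (H¹(F, W_j) → H¹(F, W_j / Fil_j))`, the SATURATED level-`1` condition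
`levelCondition red p C 1 = {x₁ : x ∈ lim_j H¹(F, W_j), ∃ a ∀ j, p^a x_j ∈ C_j}`, a residual presentation `π̄ : W 1 → N` with
`π̄(Fil 1) ⊆ Fil_N`.  Then, under three MODULE-LEVEL inputs —
(H0) no `Γ_F`-fixed vector in `W (1+a) / (Fil + f 1 (1+a) (W 1))` beyond `Fil + f(W 1)` (non-anomalous reduction),
(PUR) `f 1 (1+a) u ∈ Fil (1+a) → u ∈ Fil 1` (the plus part is pure), and
(LIFT) every residual strict class lifts to the strict core of every level (`H²(F, Fil) = 0`, discharged elsewhere) —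
* §1 `map_strictSubgroup_le_strictSubgroup` — `H¹` of an equivariant map carrying `W⁺` into `W'⁺` carries `H¹_str` into `H¹_str`
  (cocycles modulo the plus part); the reductions preserve the cores;
* §2 **`apply_one_mem_strictSubgroup_of_mem_saturatedFamilies`** — the `1`-component of a SATURATED family already lies in the
  STRICT core `C_1` (from (H0), (PUR): `p^a x_{1+a} = H¹(f 1 (1+a)) x_1`, cocycle bookkeeping);
* §3 **`map_levelCondition_one_eq_strictSubgroup`** — `H¹(π̄)(levelCondition red p C 1) = H¹_str(F, Fil_N)`: `⊆` by §1–§2, `⊇` by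
  Kőnig (`Tower.exists_mem_compatibleFamilies_of_forall_mem`) on the `red`-stable constraint sets
  `{x ∈ C_j | H¹(π̄)(H¹(f j 1) x) = r}`, nonempty by (LIFT).
For the curve (`W_j = E[p^j] ⊗ A_{m,j}(ψ)` at `w ∣ p`, `N = E[p]`, `Fil = Fil_w`) this is «`F̄_𝔮(w)` = the ordinary kernel
`ker (H¹(K_w, E[p]) → H¹(K_w, E[p] / Fil_w E[p]))`» for non-anomalous `w`, the input of Howard's H.5(b) at `w ∣ p`.
No summit statement is proved; BSD is not proved by any of this.  Seat `bsd-line-x9-p1-w3` g5.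

References: [Howard2004HeegnerKolyvagin] Def. 1.1.3, Def. 2.1.1, §3.1–3.2, Def. 3.2.6; [MazurRubinMemoirs2004] Def. 1.1.1, Example 1.1.2,
Lemma 3.7.1; [GreenbergLNM1716] §2; [SerreGaloisCohomology1997] I §2.2, §5.8.
-/

noncomputable section

open CategoryTheory Field
open scoped ContRepresentation

universe u

namespace Literature.NumberTheory.EllipticCurves

namespace Tower

open Literature.NumberTheory.GaloisRepresentations

variable {F : Type u} [Field F]

/-! ## §1 `H¹` of a map compatible with the plus parts preserves the strict kernels -/

/-- A class dies in `H¹(F, W/W⁺)` iff its cocycle is a coboundary modulo `W⁺` (private copy of the criterion of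
`Howard2004/TransportStrictKernelProofs`). [folklore] -/
private theorem quotientMap_class_eq_zero_iff {M : Type u} [AddCommGroup M] [TopologicalSpace M] [DiscreteTopology M]
    (τ : DiscreteGaloisModule F M) (Mp : Submodule ℤ M) (h : ∀ σ : absoluteGaloisGroup F, Mp ≤ Mp.comap (τ σ))
    (c : contOneCocycles τ.toTopRep) :
    τ.quotientMap Mp h 1 (oneCocycleClass _ c) = 0 ↔ ∃ e : M, ∀ g : absoluteGaloisGroup F, c.1 g - (τ g e - e) ∈ Mp := by
  have hq : τ.quotientMap Mp h 1 (oneCocycleClass _ c) =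
      ContinuousCohomology.map (ContinuousMonoidHom.id (absoluteGaloisGroup F)) (X := τ.toTopRep)
        (Y := DiscreteGaloisModule.toTopRep (τ.quotient Mp h))
        (TopRep.ofHom ⟨⟨Mp.mkQ.toAddMonoidHom.toIntLinearMap, continuous_of_discreteTopology⟩,
          fun g ↦ ContinuousLinearMap.ext fun x ↦ rfl⟩) 1 (oneCocycleClass _ c) := rfl
  rw [hq, map_oneCocycleClass]
  constructor
  · intro h0
    obtain ⟨q, hq⟩ := (oneCocycleClass_eq_zero_iff _ _).mp h0
    obtain ⟨e, rfl⟩ := Submodule.mkQ_surjective Mp q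
    refine ⟨e, fun g ↦ ?_⟩
    have hg := hq g
    change Mp.mkQ (c.1 g) = Mp.mkQ (τ g e) - Mp.mkQ e at hg
    rw [← map_sub, Submodule.mkQ_apply, Submodule.mkQ_apply, Submodule.Quotient.eq] at hg
    exact hg
  · rintro ⟨e, he⟩
    refine (oneCocycleClass_eq_zero_iff _ _).mpr ⟨Mp.mkQ e, fun g ↦ ?_⟩
    change Mp.mkQ (c.1 g) = Mp.mkQ (τ g e) - Mp.mkQ e
    rw [← map_sub, Submodule.mkQ_apply, Submodule.mkQ_apply, Submodule.Quotient.eq]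
    exact he g

/-- An equivariant map intertwines the actions on elements. [folklore] -/
private theorem hom_apply_smul {M₁ M₂ : Type u} [AddCommGroup M₁] [TopologicalSpace M₁] [DiscreteTopology M₁]
    [AddCommGroup M₂] [TopologicalSpace M₂] [DiscreteTopology M₂] {τ₁ : DiscreteGaloisModule F M₁}
    {τ₂ : DiscreteGaloisModule F M₂} (g : τ₁.toContRepresentation →ⁱL τ₂.toContRepresentation)
    (σ : absoluteGaloisGroup F) (x : M₁) : g (τ₁ σ x) = τ₂ σ (g x) :=
  congrArg (fun φ ↦ φ x) (g.isIntertwining' σ)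

/-- **`H¹(g)` carries `H¹_str(F, W₁⁺)` into `H¹_str(F, W₂⁺)` when `g(W₁⁺) ⊆ W₂⁺`** (a cocycle that is a coboundary
modulo `W₁⁺` maps to one that is a coboundary modulo `W₂⁺`). [cite: GreenbergLNM1716, §2 (functoriality of the ordinary condition)]
[cite: Howard2004HeegnerKolyvagin, §3.1 (arXiv p. 15, L56–66)] -/
theorem map_strictSubgroup_le_strictSubgroup {M₁ M₂ : Type u} [AddCommGroup M₁] [TopologicalSpace M₁]
    [DiscreteTopology M₁] [AddCommGroup M₂] [TopologicalSpace M₂] [DiscreteTopology M₂]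
    (τ₁ : DiscreteGaloisModule F M₁) (τ₂ : DiscreteGaloisModule F M₂)
    (g : τ₁.toContRepresentation →ⁱL τ₂.toContRepresentation)
    (P₁ : Submodule ℤ M₁) (h₁ : ∀ σ : absoluteGaloisGroup F, P₁ ≤ P₁.comap (τ₁ σ))
    (P₂ : Submodule ℤ M₂) (h₂ : ∀ σ : absoluteGaloisGroup F, P₂ ≤ P₂.comap (τ₂ σ)) (hg : ∀ x ∈ P₁, g x ∈ P₂) :
    (τ₁.strictSubgroup P₁ h₁).map (galoisCohomology.map g 1) ≤ τ₂.strictSubgroup P₂ h₂ := by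
  rintro _ ⟨c, hc, rfl⟩
  obtain ⟨ζ, rfl⟩ := oneCocycleClass_surjective _ c
  obtain ⟨e, he⟩ := (quotientMap_class_eq_zero_iff τ₁ P₁ h₁ ζ).mp hc
  change (τ₂.quotientMap P₂ h₂ 1) (galoisCohomology.map g 1 (oneCocycleClass _ ζ)) = 0
  rw [galoisCohomology.map_oneCocycleClass_ofHom]
  refine (quotientMap_class_eq_zero_iff τ₂ P₂ h₂ _).mpr ⟨g e, fun σ ↦ ?_⟩
  change g (ζ.1 σ) - (τ₂ σ (g e) - g e) ∈ P₂
  rw [← hom_apply_smul g σ e, ← map_sub, ← map_sub]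
  exact hg _ (he σ)

variable {W : ℕ → Type u} [∀ j, AddCommGroup (W j)] [∀ j, TopologicalSpace (W j)] [∀ j, DiscreteTopology (W j)]
  (ρ : ∀ j, DiscreteGaloisModule F (W j))
  (f : ∀ a b, (ρ a).toContRepresentation →ⁱL (ρ b).toContRepresentation)
  (Fil : ∀ j, Submodule ℤ (W j)) (hFil : ∀ (j : ℕ) (σ : absoluteGaloisGroup F), Fil j ≤ (Fil j).comap ((ρ j) σ))

/-- The reductions carry the strict cores into the strict cores. [cite: Howard2004HeegnerKolyvagin, §3.1 and Def. 3.2.6] -/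
theorem map_strictSubgroup_le (hFf : ∀ (a b : ℕ) (x : W a), x ∈ Fil a → f a b x ∈ Fil b) (a b : ℕ) :
    ((ρ a).strictSubgroup (Fil a) (hFil a)).map (galoisCohomology.map (f a b) 1) ≤ (ρ b).strictSubgroup (Fil b) (hFil b) :=
  map_strictSubgroup_le_strictSubgroup (ρ a) (ρ b) (f a b) (Fil a) (hFil a) (Fil b) (hFil b) (hFf a b)

/-! ## §2 The `1`-component of a saturated family lies in the strict core -/

/-- **`x_1 ∈ C_1` for every saturated family `x`** (strict cores): with `a` such that `p^a x_j ∈ C_j` for all `j`,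
`p^a x_{1+a} = H¹(f 1 (1+a)) x_1`, so the cocycle `ζ` of `x_1` satisfies `f(ζ) ≡ ∂b (mod Fil)`; the class of `b` in
`W (1+a) / (Fil + f(W 1))` is `Γ_F`-fixed, so by (H0) `b = φ₀ + f b₁`, and `f(ζ − ∂b₁) ∈ Fil`, whence `ζ ≡ ∂b₁ (mod Fil 1)` by (PUR).
[cite: Howard2004HeegnerKolyvagin, §3.1–3.2 (arXiv p. 15 L62–66, p. 16 L5–6)] [cite: GreenbergLNM1716, §2] -/
theorem apply_one_mem_strictSubgroup_of_mem_saturatedFamilies (hid : ∀ a (w : W a), f a a w = w)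
    (hcomp : ∀ a b c, c ≤ b → b ≤ a → ∀ w : W a, f b c (f a b w) = f a c w)
    (p : ℕ) (hpow : ∀ ℓ n (w : W (ℓ + n)), f ℓ (ℓ + n) (f (ℓ + n) ℓ w) = p ^ n • w)
    (H0 : ∀ (a : ℕ) (b : W (1 + a)),
      (∀ g : absoluteGaloisGroup F, ∃ φ ∈ Fil (1 + a), ∃ c : W 1, (ρ (1 + a)) g b - b = φ + f 1 (1 + a) c) →
        ∃ φ₀ ∈ Fil (1 + a), ∃ b₁ : W 1, b = φ₀ + f 1 (1 + a) b₁)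
    (PUR : ∀ (a : ℕ) (u : W 1), f 1 (1 + a) u ∈ Fil (1 + a) → u ∈ Fil 1)
    {x : Π j, galoisCohomology (ρ j) 1}
    (hx : x ∈ saturatedFamilies (H := fun j ↦ galoisCohomology (ρ j) 1) (fun j ↦ galoisCohomology.map (f (j + 1) j) 1)
      p (fun j ↦ (ρ j).strictSubgroup (Fil j) (hFil j))) :
    x 1 ∈ (ρ 1).strictSubgroup (Fil 1) (hFil 1) := by
  obtain ⟨hxc, a, ha⟩ := (mem_saturatedFamilies_iff (H := fun j ↦ galoisCohomology (ρ j) 1) _ p _ x).mp hx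
  have hxc' : x ∈ compatibleFamilies (H := fun j ↦ galoisCohomology (ρ j) 1)
      (fun j ↦ galoisCohomology.map (f (j + 1) j) 1) := (mem_compatibleFamilies_iff _ x).mpr hxc
  -- `H¹(f 1 (1+a)) (x 1) = p^a • x (1+a) ∈ C (1+a)`
  have hup : galoisCohomology.map (f 1 (1 + a)) 1 (x 1) = p ^ a • x (1 + a) := by
    rw [← map_apply_eq_of_mem ρ f hid hcomp hxc' (Nat.le_add_right 1 a),
      galoisCohomology.map_map_of_comp_apply (f (1 + a) 1) (f 1 (1 + a))
        (DiscreteGaloisModule.scalarIntertwining _ (DiscreteGaloisModule.isScalarLinear_int _) ((p ^ a : ℕ) : ℤ))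
        (fun w ↦ by rw [DiscreteGaloisModule.scalarIntertwining_apply, natCast_zsmul, hpow 1 a w]),
      map_natCastIntertwining_eq_nsmul]
  have hmem : galoisCohomology.map (f 1 (1 + a)) 1 (x 1) ∈ (ρ (1 + a)).strictSubgroup (Fil (1 + a)) (hFil (1 + a)) := by
    rw [hup]; exact ha (1 + a)
  obtain ⟨ζ, hζ⟩ := oneCocycleClass_surjective _ (x 1)
  rw [← hζ] at hmem ⊢
  rw [galoisCohomology.map_oneCocycleClass_ofHom] at hmem
  obtain ⟨b, hb⟩ := (quotientMap_class_eq_zero_iff _ _ _ _).mp hmem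
  -- `hb g : f (ζ g) - (g b - b) ∈ Fil (1+a)`
  have hb' : ∀ g : absoluteGaloisGroup F, f 1 (1 + a) (ζ.1 g) - ((ρ (1 + a)) g b - b) ∈ Fil (1 + a) := hb
  obtain ⟨φ₀, hφ₀, b₁, hbφ⟩ := H0 a b fun g ↦ ⟨-(f 1 (1 + a) (ζ.1 g) - ((ρ (1 + a)) g b - b)),
    (Fil (1 + a)).neg_mem (hb' g), ζ.1 g, by abel⟩
  refine (quotientMap_class_eq_zero_iff _ _ _ _).mpr ⟨b₁, fun g ↦ PUR a _ ?_⟩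
  have key : f 1 (1 + a) (ζ.1 g - ((ρ 1) g b₁ - b₁)) =
      (f 1 (1 + a) (ζ.1 g) - ((ρ (1 + a)) g b - b)) + ((ρ (1 + a)) g φ₀ - φ₀) := by
    rw [map_sub, map_sub, hom_apply_smul (f 1 (1 + a)) g b₁, hbφ, map_add]; abel
  rw [key]
  exact (Fil (1 + a)).add_mem (hb' g) ((Fil (1 + a)).sub_mem (hFil (1 + a) g hφ₀) hφ₀)

/-! ## §3 The propagated saturated condition is the residual strict kernel -/

variable {N : Type u} [AddCommGroup N] [TopologicalSpace N] [DiscreteTopology N] (ρN : DiscreteGaloisModule F N)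
  (πbar : (ρ 1).toContRepresentation →ⁱL ρN.toContRepresentation)
  (FilN : Submodule ℤ N) (hFilN : ∀ σ : absoluteGaloisGroup F, FilN ≤ FilN.comap (ρN σ))

/-- **`H¹(π̄)(levelCondition red p C 1) = H¹_str(F, Fil_N)`** for strict cores `C_j`, under (H0), (PUR) and (LIFT): the
saturated condition of the tower, propagated to the residual module, is the residual strict (ordinary) kernel.  `⊆`: §2 and §1.
`⊇`: for `r ∈ H¹_str(F, Fil_N)` the constraint sets `S_j = {x ∈ C_j | H¹(π̄)(H¹(f j 1) x) = r}` are nonempty (LIFT) and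
`red`-stable, so Kőnig gives a compatible — hence saturated, with `a = 0` — family through them.
[cite: Howard2004HeegnerKolyvagin, Def. 2.1.1, §3.1–3.2 (arXiv p. 15 L62–66, p. 16 L5–6)] [cite: MazurRubinMemoirs2004, Lemma 3.7.1]
[cite: SerreGaloisCohomology1997, I §2.2] -/
theorem map_levelCondition_one_eq_strictSubgroup [∀ j, Finite (galoisCohomology (ρ j) 1)]
    (hFf : ∀ (a b : ℕ) (x : W a), x ∈ Fil a → f a b x ∈ Fil b) (hπ : ∀ x ∈ Fil 1, πbar x ∈ FilN)
    (hid : ∀ a (w : W a), f a a w = w)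
    (hcomp : ∀ a b c, c ≤ b → b ≤ a → ∀ w : W a, f b c (f a b w) = f a c w)
    (p : ℕ) (hpow : ∀ ℓ n (w : W (ℓ + n)), f ℓ (ℓ + n) (f (ℓ + n) ℓ w) = p ^ n • w)
    (H0 : ∀ (a : ℕ) (b : W (1 + a)),
      (∀ g : absoluteGaloisGroup F, ∃ φ ∈ Fil (1 + a), ∃ c : W 1, (ρ (1 + a)) g b - b = φ + f 1 (1 + a) c) →
        ∃ φ₀ ∈ Fil (1 + a), ∃ b₁ : W 1, b = φ₀ + f 1 (1 + a) b₁)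
    (PUR : ∀ (a : ℕ) (u : W 1), f 1 (1 + a) u ∈ Fil (1 + a) → u ∈ Fil 1)
    (LIFT : ∀ j, 1 ≤ j → ∀ r ∈ ρN.strictSubgroup FilN hFilN, ∃ x ∈ (ρ j).strictSubgroup (Fil j) (hFil j),
      galoisCohomology.map πbar 1 (galoisCohomology.map (f j 1) 1 x) = r) :
    (levelCondition (H := fun j ↦ galoisCohomology (ρ j) 1) (fun j ↦ galoisCohomology.map (f (j + 1) j) 1) p
        (fun j ↦ (ρ j).strictSubgroup (Fil j) (hFil j)) 1).map (galoisCohomology.map πbar 1) =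
      ρN.strictSubgroup FilN hFilN := by
  apply le_antisymm
  · -- `⊆`
    rintro _ ⟨y, hy, rfl⟩
    obtain ⟨x, hx, rfl⟩ := (mem_levelCondition_iff (H := fun j ↦ galoisCohomology (ρ j) 1) _ p _ 1 y).mp hy
    exact map_strictSubgroup_le_strictSubgroup (ρ 1) ρN πbar (Fil 1) (hFil 1) FilN hFilN hπ
      ⟨x 1, apply_one_mem_strictSubgroup_of_mem_saturatedFamilies ρ f Fil hFil hid hcomp p hpow H0 PUR hx, rfl⟩
  · -- `⊇` by Kőnig
    intro r hr
    let S : ∀ j, Set (galoisCohomology (ρ j) 1) := fun j ↦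
      {x | x ∈ (ρ j).strictSubgroup (Fil j) (hFil j) ∧
        (1 ≤ j → galoisCohomology.map πbar 1 (galoisCohomology.map (f j 1) 1 x) = r)}
    have hst : ∀ j, ∀ w ∈ S (j + 1), galoisCohomology.map (f (j + 1) j) 1 w ∈ S j := by
      rintro j w ⟨hw, hwr⟩
      refine ⟨map_strictSubgroup_le ρ f Fil hFil hFf (j + 1) j ⟨w, hw, rfl⟩, fun hj ↦ ?_⟩
      rw [galoisCohomology.map_map_of_comp_apply (f (j + 1) j) (f j 1) (f (j + 1) 1)
        (fun w ↦ (hcomp _ _ _ hj (Nat.le_succ j) w).symm)]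
      exact hwr (Nat.le_add_left 1 j)
    have hne : ∀ j, (S j).Nonempty := by
      intro j
      rcases Nat.eq_zero_or_pos j with rfl | hj
      · obtain ⟨x, hx, hxr⟩ := LIFT 1 le_rfl r hr
        exact ⟨_, hst 0 x ⟨hx, fun _ ↦ hxr⟩⟩
      · obtain ⟨x, hx, hxr⟩ := LIFT j hj r hr
        exact ⟨x, hx, fun _ ↦ hxr⟩
    obtain ⟨x, hxc, hxS⟩ := exists_mem_compatibleFamilies_of_forall_mem
      (H := fun j ↦ galoisCohomology (ρ j) 1) (fun j ↦ galoisCohomology.map (f (j + 1) j) 1) S hne hst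
    have hsat : x ∈ saturatedFamilies (H := fun j ↦ galoisCohomology (ρ j) 1)
        (fun j ↦ galoisCohomology.map (f (j + 1) j) 1) p (fun j ↦ (ρ j).strictSubgroup (Fil j) (hFil j)) :=
      (mem_saturatedFamilies_iff (H := fun j ↦ galoisCohomology (ρ j) 1) _ p _ x).mpr ⟨(mem_compatibleFamilies_iff _ x).mp hxc, 0, fun j ↦ by
        rw [pow_zero, one_smul]; exact (hxS j).1⟩
    refine ⟨x 1, (mem_levelCondition_iff (H := fun j ↦ galoisCohomology (ρ j) 1) _ p _ 1 (x 1)).mpr ⟨x, hsat, rfl⟩, ?_⟩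
    have h1 := (hxS 1).2 le_rfl
    rwa [map_apply_eq_self_of_forall_apply_eq (f 1 1) (hid 1)] at h1

end Tower

end Literature.NumberTheory.EllipticCurves

end
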